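import Mathlib.LinearAlgebra.RootSystem.Base
import Mathlib.LinearAlgebra.RootSystem.WeylGroup
import Mathlib.LinearAlgebra.RootSystem.Finite.CanonicalBilinear
import Literature.NumberTheory.Automorphic.ChevalleyData
import Literature.NumberTheory.Automorphic.RootDatumBaseChange
import Literature.NumberTheory.Automorphic.BasePosCoweight
import HarnessLib

/-!
# Weights of a based root datum: the coroot `2ρ^∨`, dominance, finiteness

Trunk T-AUTOMORPHIC (G25 AutomorphicL); root-datum combinatorics for the highest-weight step of
Chevalley's existence theorem (`Literature.NumberTheory.Automorphic.chevalley_existence`,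
Springer 10.1.1). For a reduced root datum `P` over `ℤ` with base `b` (finitely many roots):

* with `b.twoRhoCoroot = ∑_{β > 0} β^∨` and `⟨β, 2ρ^∨⟩ = 2 ht(β)` (the tree's
  `BasePosCoweight.lean`), a non-trivial `ℕ`-combination of negative roots is non-zero
  (`eq_zero_of_sum_nsmul_root_eq_zero`);
* **coroots of positive roots are `ℕ`-combinations of simple coroots**
  (`corootCoord_nonneg`, through `(α, α) α^∨ = 2 Pol(α)`, Mathlib
  `RootPairing.rootForm_self_smul_coroot`), hence `⟨μ, β^∨⟩ ≥ 0` for dominant `μ`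
  (`IsDominant`) and positive `β` (`toLinearMap_coroot_nonneg_of_isDominant`);
* **finiteness of the dominant weights of the form `λ - ∑ d_s α_s`, `d_s ∈ ℕ`**
  (`finite_setOf_isDominant_sub`: `2 ∑ d_s ≤ ⟨λ, 2ρ^∨⟩`);
* the **root lattice meets the orthogonal of the simple coroots trivially**
  (`eq_zero_of_mem_rootSpan_of_forall_coroot`, the Cartan matrix being non-degenerate,
  `RootDatumBaseChange.cartanMatrix_nondegenerate_int`);
* **the Weyl group of a finite root datum is finite** (`finite_weylGroup`: its permutation
  representation on the roots is faithful, `weylGroupToPerm_injective` — the TODO of Mathlib's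
  `Mathlib.LinearAlgebra.RootSystem.WeylGroup`, here over `ℤ` in the presence of a base), and the
  **finiteness of sets of weights below `λ` stable under the simple reflections**
  (`finite_of_forall_reflection_mem`: every orbit of the group generated by the simple
  reflections contains a dominant weight, `exists_isDominant_smul`), the combinatorial heart
  of `dim L(λ) < ∞` (Humphreys §13.2, §21.2).

Everything is proved; the statements are [folklore] (Bourbaki *Lie* VI §1.5–1.10, VIII §7.2;
Humphreys §10.3, §13.2, §21.2).

## Mathlib

`RootPairing.Base` (`IsPos`, `height`, `induction_add`, `exists_root_eq_sum_nat_or_neg`,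
`linearIndepOn_coroot`, `span_root_support`, `cartanMatrix`), `RootPairing.RootForm`
(`rootForm_self_smul_coroot`, `rootForm_pos_of_ne_zero` over the ordered ring `ℤ`),
`RootPairing.weylGroup`, `RootPairing.Equiv.reflection`, `RootPairing.weylGroupToPerm`; the tree's
`corootCoord` (`ChevalleyData.lean`) and `cartanMatrix_nondegenerate_int`
(`RootDatumBaseChange.lean`). Nothing here duplicates Mathlib: Mathlib has no `ρ^∨`, dominance or
Weyl-group finiteness for root pairings at present.
-/

noncomputable section

open Set Function Module

namespace Literature.NumberTheory.Automorphic

namespace RootDatumWeights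

variable {ι X Y : Type*} [AddCommGroup X] [AddCommGroup Y] [Fintype ι] (P : RootPairing ι ℤ X Y) (b : P.Base)

/-! ### Coroots of positive roots are `ℕ`-combinations of the simple coroots -/

/-- The root form is positive on roots (a root datum over `ℤ`). [folklore] -/
lemma rootForm_root_pos (i : ι) : 0 < P.RootForm (P.root i) (P.root i) :=
  P.rootForm_pos_of_ne_zero (Submodule.subset_span (mem_range_self i)) (P.ne_zero i)

omit [Fintype ι] in
/-- A positive root is an `ℕ`-combination of the simple roots. [folklore] -/
lemma exists_root_eq_sum_nat_of_isPos {i : ι} (hi : b.IsPos i) :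
    ∃ f : ι → ℕ, P.root i = ∑ j ∈ b.support, f j • P.root j := by
  obtain ⟨f, -, hf | hf⟩ := b.exists_root_eq_sum_nat_or_neg i
  · exact ⟨f, hf⟩
  · exfalso
    have hneg : P.root i = ∑ j ∈ b.support, (-(f j : ℤ)) • P.root j := by
      rw [hf, ← Finset.sum_neg_distrib]
      refine Finset.sum_congr rfl fun j _ => ?_
      rw [neg_smul, Nat.cast_smul_eq_nsmul]
    have hh := b.height_eq_sum hneg
    rw [RootPairing.Base.isPos_iff, hh] at hi
    have : ∑ j ∈ b.support, (-(f j : ℤ)) ≤ 0 := Finset.sum_nonpos fun j _ => by simp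
    omega

/-- **The coordinates of the coroot of a positive root in the simple coroots are non-negative**:
`(α, α) c_{α s} = n_s (α_s, α_s)` where `α = ∑ n_s α_s`, from `(α, α) α^∨ = 2 Pol(α)` and the
linearity of the polarization (Mathlib `RootPairing.rootForm_self_smul_coroot`). [folklore] -/
theorem corootCoord_nonneg {i : ι} (hi : b.IsPos i) (s : b.support) : 0 ≤ corootCoord P b i s := by
  obtain ⟨f, hf⟩ := exists_root_eq_sum_nat_of_isPos P b hi
  -- `(α, α) α^∨ = ∑_t f_t (α_t, α_t) α_t^∨`
  have key : P.RootForm (P.root i) (P.root i) • P.coroot i =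
      ∑ t ∈ b.support, ((f t : ℤ) * P.RootForm (P.root t) (P.root t)) • P.coroot t := by
    rw [P.rootForm_self_smul_coroot i, hf, map_sum, Finset.smul_sum]
    refine Finset.sum_congr rfl fun t _ => ?_
    rw [map_nsmul, smul_comm, ← P.rootForm_self_smul_coroot t, ← Nat.cast_smul_eq_nsmul ℤ, smul_smul]
  -- rewrite the left side through the coordinates and compare coefficients
  have hli := b.linearIndepOn_coroot
  rw [← sum_corootCoord_smul P b i, Finset.smul_sum] at key
  simp_rw [smul_smul] at key
  -- both sides are combinations of the independent simple coroots
  have hcoef : P.RootForm (P.root i) (P.root i) * corootCoord P b i s =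
      (f s : ℤ) * P.RootForm (P.root s) (P.root s) := by
    classical
    have h1 : ∑ t : b.support, (P.RootForm (P.root i) (P.root i) * corootCoord P b i t -
        (if h : (t : ι) ∈ b.support then (f t : ℤ) * P.RootForm (P.root t) (P.root t) else 0)) • P.coroot (t : ι) = 0 := by
      rw [Finset.sum_congr rfl fun t _ => sub_smul _ _ _, Finset.sum_sub_distrib, sub_eq_zero, key]
      rw [← Finset.sum_coe_sort b.support]
      refine Finset.sum_congr rfl fun t _ => ?_
      rw [dif_pos t.2]
    have := linearIndependent_iff'.1 hli Finset.univ _ h1 s (Finset.mem_univ s)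
    rw [dif_pos s.2, sub_eq_zero] at this
    exact this
  have hpos := rootForm_root_pos P i
  have hpos' := rootForm_root_pos P (s : ι)
  have h0 : 0 ≤ P.RootForm (P.root i) (P.root i) * corootCoord P b i s := by
    rw [hcoef]; exact mul_nonneg (Nat.cast_nonneg _) hpos'.le
  exact le_of_mul_le_mul_left (by rwa [mul_zero]) hpos

/-! ### Dominant weights -/

/-- A weight `μ ∈ X` is **dominant** (for the base `b`) if `⟨μ, α_s^∨⟩ ≥ 0` for every simple
root `α_s`. [folklore] -/
def IsDominant (μ : X) : Prop := ∀ s ∈ b.support, 0 ≤ P.toLinearMap μ (P.coroot s)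

/-- **A dominant weight pairs non-negatively with every positive coroot.** [folklore] -/
theorem toLinearMap_coroot_nonneg_of_isDominant {μ : X} (hμ : IsDominant P b μ) {i : ι}
    (hi : b.IsPos i) : 0 ≤ P.toLinearMap μ (P.coroot i) := by
  rw [toLinearMap_coroot_eq_sum P b μ i]
  exact Finset.sum_nonneg fun s _ => mul_nonneg (corootCoord_nonneg P b hi s) (hμ s s.2)

/-- `⟨μ, 2ρ^∨⟩ ≥ 0` for dominant `μ`. [folklore] -/
theorem toLinearMap_twoRhoCoroot_nonneg_of_isDominant {μ : X} (hμ : IsDominant P b μ) :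
    0 ≤ P.toLinearMap μ b.twoRhoCoroot := by
  rw [RootPairing.Base.twoRhoCoroot, map_sum]
  exact Finset.sum_nonneg fun i hi =>
    toLinearMap_coroot_nonneg_of_isDominant P b hμ (Finset.mem_filter.1 hi).2

/-- `⟨λ - ∑ d_s α_s, 2ρ^∨⟩ = ⟨λ, 2ρ^∨⟩ - 2 ∑ d_s`. [folklore] -/
lemma toLinearMap_sub_sum_twoRhoCoroot [P.IsReduced] (lam : X) (d : b.support → ℕ) :
    P.toLinearMap (lam - ∑ s : b.support, d s • P.root (s : ι)) b.twoRhoCoroot =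
      P.toLinearMap lam b.twoRhoCoroot - ∑ s, 2 * (d s : ℤ) := by
  rw [map_sub, LinearMap.sub_apply, map_sum, LinearMap.sum_apply]
  refine congrArg _ (Finset.sum_congr rfl fun s _ => ?_)
  rw [map_nsmul, LinearMap.smul_apply, b.root'_twoRhoCoroot_of_mem_support s.2, nsmul_eq_mul,
    mul_comm]

/-- **Finiteness of the dominant weights of the form `λ - ∑ d_s α_s`, `d_s ∈ ℕ`**
(`2 ∑ d_s ≤ ⟨λ, 2ρ^∨⟩`). [folklore] -/
theorem finite_setOf_isDominant_sub [P.IsReduced] (lam : X) :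
    {μ : X | IsDominant P b μ ∧ ∃ d : b.support → ℕ, μ = lam - ∑ s : b.support, d s • P.root (s : ι)}.Finite := by
  set M := P.toLinearMap lam b.twoRhoCoroot
  have key : ∀ d : b.support → ℕ, IsDominant P b (lam - ∑ s : b.support, d s • P.root (s : ι)) →
      ∀ s, (d s : ℤ) ≤ M := by
    intro d hd s
    have h0 := toLinearMap_twoRhoCoroot_nonneg_of_isDominant P b hd
    rw [toLinearMap_sub_sum_twoRhoCoroot] at h0
    have hle : 2 * (d s : ℤ) ≤ ∑ t, 2 * (d t : ℤ) :=
      Finset.single_le_sum (f := fun t => 2 * (d t : ℤ)) (fun t _ => by positivity) (Finset.mem_univ s)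
    linarith
  have hfin : {d : b.support → ℕ | ∀ s, d s ∈ Set.Iic M.toNat}.Finite :=
    Set.Finite.pi' fun _ => Set.finite_Iic _
  refine (hfin.image fun d => lam - ∑ s : b.support, d s • P.root (s : ι)).subset ?_
  rintro μ ⟨hμ, d, rfl⟩
  refine ⟨d, fun s => ?_, rfl⟩
  have := key d hμ s
  simp only [Set.mem_Iic]
  omega

/-! ### The root lattice meets the orthogonal of the simple coroots trivially -/

omit [Fintype ι] in
/-- The Cartan matrix entries are the pairings `⟨α_s, α_t^∨⟩`. [folklore] -/
lemma cartanMatrix_apply (s t : b.support) : b.cartanMatrix s t = P.pairing s t := by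
  simpa using b.algebraMap_cartanMatrixIn_apply ℤ s t

/-- **An element of the root lattice orthogonal to all simple coroots is zero** (non-degeneracy
of the Cartan matrix, `cartanMatrix_nondegenerate_int`). [folklore] -/
theorem eq_zero_of_mem_rootSpan_of_forall_coroot [Module.Finite ℤ X] {d : X}
    (hd : d ∈ P.rootSpan ℤ) (h0 : ∀ s ∈ b.support, P.toLinearMap d (P.coroot s) = 0) : d = 0 := by
  have hd' : d ∈ Submodule.span ℤ (Set.range fun s : b.support => P.root (s : ι)) := by
    have e : Set.range (fun s : b.support => P.root (s : ι)) = P.root '' (b.support : Set ι) :=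
      (Set.image_eq_range P.root (b.support : Set ι)).symm
    rw [e, b.span_root_support]
    exact hd
  obtain ⟨v, rfl⟩ := (Submodule.mem_span_range_iff_exists_fun ℤ).1 hd'
  have hvA : Matrix.vecMul v b.cartanMatrix = 0 := by
    funext t
    change ∑ s, v s * b.cartanMatrix s t = 0
    have := h0 t t.2
    rw [map_sum, LinearMap.sum_apply] at this
    simp_rw [map_smul, LinearMap.smul_apply, RootPairing.root_coroot_eq_pairing, smul_eq_mul] at this
    simpa only [cartanMatrix_apply] using this
  have hv : v = 0 := (Matrix.separatingLeft_iff_forall_vecMul_eq_zero.1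
    (RootDatumBaseChange.cartanMatrix_nondegenerate_int P b).separatingLeft) v hvA
  simp [hv]

/-- Two weights congruent modulo the root lattice with the same pairings against the simple
coroots are equal. [folklore] -/
theorem eq_of_sub_mem_rootSpan [Module.Finite ℤ X] {μ ν : X} (h : μ - ν ∈ P.rootSpan ℤ)
    (hp : ∀ s ∈ b.support, P.toLinearMap μ (P.coroot s) = P.toLinearMap ν (P.coroot s)) : μ = ν :=
  sub_eq_zero.1 (eq_zero_of_mem_rootSpan_of_forall_coroot P b h fun s hs => by
    rw [map_sub, LinearMap.sub_apply, hp s hs, sub_self])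

/-! ### Non-trivial `ℕ`-combinations of negative roots are non-zero -/

/-- **A non-trivial `ℕ`-combination of negative roots is non-zero**:
`⟨∑ n_c β_c, 2ρ^∨⟩ = 2 ∑ n_c ht(β_c) < 0` unless all `n_c = 0`. [folklore] -/
theorem eq_zero_of_sum_nsmul_root_eq_zero [P.IsReduced] {κ : Type*} (t : Finset κ) (f : κ → ι) (n : κ → ℕ)
    (hneg : ∀ c ∈ t, ¬ b.IsPos (f c)) (h0 : ∑ c ∈ t, n c • P.root (f c) = 0) :
    ∀ c ∈ t, n c = 0 := by
  have h := congrArg (fun x => P.toLinearMap x b.twoRhoCoroot) h0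
  simp only [map_sum, map_nsmul, LinearMap.sum_apply, LinearMap.smul_apply, map_zero,
    LinearMap.zero_apply, RootPairing.Base.root'_twoRhoCoroot, nsmul_eq_mul] at h
  have hle : ∀ c ∈ t, (n c : ℤ) * (2 * b.height (f c)) ≤ 0 := fun c hc => by
    have h1 : ¬ 0 < b.height (f c) := hneg c hc
    exact mul_nonpos_of_nonneg_of_nonpos (Nat.cast_nonneg _) (by omega)
  intro c hc
  by_contra hn
  have h1 : ¬ 0 < b.height (f c) := hneg c hc
  have h2 := b.height_ne_zero (f c)
  have hlt : (n c : ℤ) * (2 * b.height (f c)) < 0 :=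
    mul_neg_of_pos_of_neg (by positivity) (by omega)
  exact hlt.ne ((Finset.sum_eq_zero_iff_of_nonpos hle).1 h c hc)

/-! ### The Weyl group is finite -/

omit [Fintype ι] in
/-- The action of an automorphism of the root datum on weights is its weight map. [folklore] -/
lemma smul_eq_weightMap (g : P.Aut) (x : X) : g • x = g.toHom.weightMap x := rfl

omit [Fintype ι] in
/-- `⟨g • x, y⟩ = ⟨x, g^*(y)⟩` for an automorphism `g` of the root datum. [folklore] -/
lemma toLinearMap_smul (g : P.Aut) (x : X) (y : Y) :
    P.toLinearMap (g • x) y = P.toLinearMap x (g.toHom.coweightMap y) := by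
  have h := LinearMap.congr_fun (RootPairing.Hom.weight_coweight_transpose_apply P P y g.toHom) x
  rw [LinearMap.dualMap_apply] at h
  rw [smul_eq_weightMap]
  simpa using h

omit [Fintype ι] in
/-- `⟨g • x, α_j^∨⟩ = ⟨x, α_{σ_g⁻¹ j}^∨⟩`. [folklore] -/
lemma toLinearMap_smul_coroot (g : P.Aut) (x : X) (j : ι) :
    P.toLinearMap (g • x) (P.coroot j) = P.toLinearMap x (P.coroot (g.toHom.indexEquiv.symm j)) := by
  rw [toLinearMap_smul, RootPairing.Hom.coroot_coweightMap_apply]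

omit [Fintype ι] in
/-- **`g • x - x` lies in the root lattice for `g` in the Weyl group.** [folklore] -/
theorem smul_sub_mem_rootSpan {g : P.Aut} (hg : g ∈ P.weylGroup) (x : X) :
    g • x - x ∈ P.rootSpan ℤ := by
  induction hg using RootPairing.weylGroup.induction generalizing x with
  | mem i =>
    rw [RootPairing.Equiv.reflection_smul, RootPairing.reflection_apply, sub_sub_cancel_left]
    exact Submodule.neg_mem _ (Submodule.smul_mem _ _ (Submodule.subset_span (mem_range_self i)))
  | one => simp
  | mul g₁ g₂ _ _ h₁ h₂ =>
    rw [mul_smul, show g₁ • g₂ • x - x = (g₁ • (g₂ • x) - g₂ • x) + (g₂ • x - x) by abel]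
    exact add_mem (h₁ _) (h₂ _)

include b in
/-- **An element of the Weyl group acting trivially on the roots acts trivially on `X`**
(`g • x - x` is in the root lattice and orthogonal to the simple coroots). [folklore] -/
theorem smul_eq_self_of_indexEquiv_eq_one [Module.Finite ℤ X] {g : P.Aut} (hg : g ∈ P.weylGroup)
    (hσ : g.toHom.indexEquiv = 1) (x : X) : g • x = x := by
  refine sub_eq_zero.1 (eq_zero_of_mem_rootSpan_of_forall_coroot P b
    (smul_sub_mem_rootSpan P hg x) fun s _ => ?_)
  rw [map_sub, LinearMap.sub_apply, toLinearMap_smul_coroot, hσ, ← Equiv.Perm.inv_def, inv_one,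
    Equiv.Perm.coe_one, id_eq, sub_self]

include b in
/-- **The permutation representation of the Weyl group of a finite root datum on the roots is
faithful.** [folklore] -/
theorem weylGroupToPerm_injective [Module.Finite ℤ X] : Function.Injective P.weylGroupToPerm := by
  intro g₁ g₂ h
  have hg : ((g₁ : P.Aut)⁻¹ * g₂) ∈ P.weylGroup := mul_mem (inv_mem g₁.2) g₂.2
  have hσ : ((g₁ : P.Aut)⁻¹ * g₂).toHom.indexEquiv = 1 := by
    change RootPairing.Equiv.indexHom P ((g₁ : P.Aut)⁻¹ * g₂) = 1
    rw [map_mul, map_inv]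
    change (P.weylGroupToPerm g₁)⁻¹ * P.weylGroupToPerm g₂ = 1
    rw [h, inv_mul_cancel]
  have key : ((g₁ : P.Aut)⁻¹ * g₂) = 1 := by
    apply RootPairing.Equiv.weightHom_injective P
    refine LinearEquiv.ext fun x => ?_
    change ((g₁ : P.Aut)⁻¹ * g₂) • x = (1 : P.Aut) • x
    rw [one_smul]
    exact smul_eq_self_of_indexEquiv_eq_one P b hg hσ x
  exact Subtype.ext (inv_mul_eq_one.1 key)

include b in
/-- **The Weyl group of a finite root datum (with a base) is finite.** [folklore] -/
theorem finite_weylGroup [Module.Finite ℤ X] : Finite P.weylGroup :=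
  Finite.of_injective _ (weylGroupToPerm_injective P b)

/-! ### Sets of weights below `λ` stable under the simple reflections are finite -/

/-- In a finite group of automorphisms containing the simple reflections, every orbit on `X`
contains a dominant weight (maximise `⟨w • μ, 2ρ^∨⟩`). [folklore] -/
theorem exists_isDominant_smul [P.IsReduced] (W : Subgroup P.Aut) [Finite W]
    (hW : ∀ s ∈ b.support, RootPairing.Equiv.reflection P s ∈ W) (μ : X) :
    ∃ w ∈ W, IsDominant P b (w • μ) := by
  haveI := Fintype.ofFinite W
  obtain ⟨w, -, hmax⟩ := Finset.exists_max_image Finset.univ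
    (fun w : W => P.toLinearMap ((w : P.Aut) • μ) b.twoRhoCoroot) Finset.univ_nonempty
  refine ⟨w, w.2, fun s hs => ?_⟩
  by_contra hneg
  replace hneg := not_le.1 hneg
  have hle := hmax ⟨_, mul_mem (hW s hs) w.2⟩ (Finset.mem_univ _)
  change P.toLinearMap ((RootPairing.Equiv.reflection P s * (w : P.Aut)) • μ) b.twoRhoCoroot ≤
    P.toLinearMap ((w : P.Aut) • μ) b.twoRhoCoroot at hle
  rw [mul_smul, RootPairing.Equiv.reflection_smul, RootPairing.reflection_apply, map_sub,
    LinearMap.sub_apply, map_zsmul, LinearMap.smul_apply,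
    b.root'_twoRhoCoroot_of_mem_support hs, smul_eq_mul] at hle
  have hneg' : P.coroot' s ((w : P.Aut) • μ) < 0 := hneg
  linarith

/-- **Finiteness of stable sets of weights below `λ`**: a set of weights of the form
`λ - ∑ d_s α_s` (`d_s ∈ ℕ`) which is stable under the simple reflections is finite — every orbit
of the (finite) group generated by the simple reflections meets the finite set of dominant such
weights. This is the combinatorial heart of `dim L(λ) < ∞` (Humphreys §21.2). [folklore] -/
theorem finite_of_forall_reflection_mem [P.IsReduced] [Module.Finite ℤ X] (lam : X) {S : Set X}
    (hsub : ∀ μ ∈ S, ∃ d : b.support → ℕ, μ = lam - ∑ s : b.support, d s • P.root (s : ι))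
    (hstab : ∀ s ∈ b.support, ∀ μ ∈ S, P.reflection s μ ∈ S) : S.Finite := by
  set W : Subgroup P.Aut :=
    Subgroup.closure (Set.range fun s : b.support => RootPairing.Equiv.reflection P (s : ι)) with hWdef
  have hWle : W ≤ P.weylGroup :=
    (Subgroup.closure_le _).2 (by rintro _ ⟨s, rfl⟩; exact P.reflection_mem_weylGroup s)
  haveI : Finite P.weylGroup := finite_weylGroup P b
  haveI : Finite W := Finite.of_injective _ (Subgroup.inclusion_injective hWle)
  have hWs : ∀ s ∈ b.support, RootPairing.Equiv.reflection P s ∈ W := fun s hs =>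
    Subgroup.subset_closure ⟨⟨s, hs⟩, rfl⟩
  -- `S` is `W`-stable
  have hstabW : ∀ g ∈ W, ∀ μ ∈ S, g • μ ∈ S := by
    intro g hg
    induction hg using Subgroup.closure_induction'' with
    | mem g hg =>
      obtain ⟨s, rfl⟩ := hg
      intro μ hμ
      rw [RootPairing.Equiv.reflection_smul]
      exact hstab s s.2 μ hμ
    | inv_mem g hg =>
      obtain ⟨s, rfl⟩ := hg
      intro μ hμ
      rw [RootPairing.Equiv.reflection_inv, RootPairing.Equiv.reflection_smul]
      exact hstab s s.2 μ hμ
    | one => intro μ hμ; simpa using hμ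
    | mul g₁ g₂ _ _ h₁ h₂ => intro μ hμ; rw [mul_smul]; exact h₁ _ (h₂ μ hμ)
  -- the dominant part of `S` is finite, and `S ⊆ W⁻¹ • (dominant part)`
  set D : Set X := {μ : X | IsDominant P b μ ∧
    ∃ d : b.support → ℕ, μ = lam - ∑ s : b.support, d s • P.root (s : ι)} with hDdef
  have hD : D.Finite := finite_setOf_isDominant_sub P b lam
  haveI : Finite D := hD.to_subtype
  refine (Set.finite_range fun p : W × D => ((p.1 : P.Aut)⁻¹) • (p.2 : X)).subset fun μ hμ => ?_
  obtain ⟨w, hw, hdom⟩ := exists_isDominant_smul P b W hWs μ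
  have hwμ : w • μ ∈ D := ⟨hdom, hsub _ (hstabW w hw μ hμ)⟩
  exact ⟨(⟨w, hw⟩, ⟨w • μ, hwμ⟩), inv_smul_smul w μ⟩

end RootDatumWeights

end Literature.NumberTheory.Automorphic
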